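import Summits.BirchSwinnertonDyer.BirchSwinnertonDyer.Theorems.CongruentShaFreeCutTwoAdicSelmerLocIndex
import Summits.BirchSwinnertonDyer.BirchSwinnertonDyer.Theorems.CongruentShaFreeCutTwoAdicSelmerCorankSupplies

/-! # Route `CongruentShaFreeCut` (rung S2) — crux `RankPosOfTwoSelmerCorankOne`
(stmt-BirchSwinnertonDyer-19079, the route's declared RESIDUAL), Link A in CORANK currency: Castella's
Selmer group `Sel_𝔭(K, E[p^∞])` over `K` is FINITE at a CORANK-one datum, GRANTED that the corank is
VISIBLE at the primes above `p` (the torsion-valued parts of the `p^k`-Selmer groups at the primes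
above `p` stay bounded) — any prime `p`, any reduction type, no `Irr`, no Mordell–Weil point

Cell `bsd-cn100`, prover seat `bsd-cn100-transfer-2` g3. Supports, does not close,
stmt-BirchSwinnertonDyer-19079 (registered stub `stub_twoAdicControlOfCorankOne` of the line of record
`heegner-field-links` v3 = the named Prop
`Theorems/CongruentShaFreeCutTwoAdicLinksCorank.TwoAdicControlOfCorankOne`, p425532). HONEST FRAMING:
label (B) — CONDITIONAL on the two TEXTBOOK named facts `poitouTate_sum_localTatePairing_eq_zero K`
(Poitou–Tate, Milne ADT I Thm. 4.10(b) with Cor. 2.3) and `localEulerPoincareCharacteristic (K_v)`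
(Milne ADT I Thm. 2.8), both hypotheses, AND on an explicit VISIBILITY hypothesis stated inline (no
new definition); nothing about BSD, crux A, crux B or the leaf `rankOne_twoConverse_congruentNumber` is
claimed. This is the corank-currency companion of the cell's rank-currency file
`Theorems/CongruentShaFreeCutTwoAdicSelmerFinite.lean` (s2-c3 g3, p429679:
`finite_selmerAcBase_of_rankOne`), whose conclusion it reaches WITHOUT a point of infinite order.

## What is proved (part 3/3; parts 1–2 = `…TwoAdicSelmerLocIndex` (Poitou–Tate with the Selmer
group's own local image; counting) and `…TwoAdicSelmerCorankSupplies` (`#𝓛_𝔮 ≤ #E(ℚ_p)_tors·p^k`;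
`corank 1 ⟹ p^k ≤ #Sel^{(p^k)}`))

* §1 `finite_and_natCard_level_le_of_locIndex_of_torsionValued`,
  `finite_selmerAcBase_of_locIndex_of_torsionValued` — Castella's level-`k` group satisfies
  `#H¹_{𝓛^{(k)}}(K, E[p^k]) ≤ [𝓛_𝔮 : loc_𝔮 Sel^{(p^k)}] · #(Sel^{(p^k)} ∩ loc_𝔭⁻¹ κ_𝔭(E(K_𝔭)_tors))`, and
  uniform bounds on the two factors give `Sel_𝔭(K, E[p^∞])` finite (tree `LevelKummer` limit).
* §2 **`finite_selmerAcBase_of_selmerCorank_eq_one_of_torsionValued`** — for an elliptic, globally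
  minimal `W/ℚ`, a prime `p`, an imaginary quadratic `K` with `p` split, `𝔭 ∋ p`:
  `corank_{ℤ_p} Sel_{p^∞}(E/K) = 1` AND «for each prime `𝔮 ∣ p` of `K` the `𝔮`-torsion-valued parts
  `Sel^{(p^k)}(E/K) ∩ loc_𝔮⁻¹ κ_𝔮(E(K_𝔮)_tors)` have order bounded in `k`» ⟹ `Sel_𝔭(K, E[p^∞])` FINITE
  (granted the two textbook facts). With the cell's landed
  `CongruentShaFreeCutTwoAdicControlOfSelmerFinite.hasCharValuationAt_of_finite_selmerAcBase` (p429171)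
  this gives `∃ m, HasCharValuationAt …` — Link A's conclusion — in CORANK currency modulo the
  visibility hypothesis; the `E_n`-specific statement (the typed residue and
  `TwoAdicControlOfCorankOne ⟸ residue`) is the sequel file `CongruentShaFreeCutTwoAdicCorankVisibility.lean`.

WHY THE VISIBILITY HYPOTHESIS IS THE HONEST RESIDUE. With `corank_{ℤ_p} Sel_{p^∞}(E/K) = 1`, Poitou–Tate
alone gives: `Sel_𝔭(K,E[p^∞])` finite ⟺ the infinitely divisible line of `Sel_{p^∞}(E/K)` does not die
in `H¹(K_𝔮, E[p^∞])` for `𝔮 ∣ p` (rank one: automatic, a point of infinite order is non-torsion in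
`E(K_𝔮)` — s2-c3's file; corank carried by `Ш[p^∞]`: genuine content). In print this is exactly what
the Heegner-point main conjecture / `Λ`-adic reciprocity law half of a `p`-converse supplies (CGLS
2022 §5.2; BCST 2022 §1) — at good ordinary `p`; for the congruent number curves at the additive prime
`2` it is open (BCST 2022 Remark D names the case).

References: [JetchevSkinnerWan2017] Prop. 3.2.1 (arXiv:1512.06894 pp. 10–11); [Castella2018] Def. 2.2,
Thm. 2.3, (3.2.1); [MilneADT2006] I Thm. 2.8, Cor. 2.3, Thm. 4.10(b), Lemma 3.3; [SilvermanAEC2009]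
Thm. X.4.2, Prop. VII.6.3; [CastellaGrossiLeeSkinner2022] §5.2; [BurungaleCastellaSkinnerTian2022] §1,
Remark D; [GreenbergLNM1716] §3. -/

noncomputable section

open scoped Classical

universe u

namespace Summit.BirchSwinnertonDyer.BirchSwinnertonDyer.Theorems.CongruentShaFreeCutTwoAdicSelmerFiniteCorank

open WeierstrassCurve NumberField IsDedekindDomain Field Function
open Literature.NumberTheory.EllipticCurves Literature.NumberTheory.EllipticCurves.GreenbergSelmer
open Literature.NumberTheory.GaloisRepresentations Literature.NumberTheory.GaloisCohomology
open Literature.NumberTheory.GaloisRepresentations.DiscreteGaloisModule (mu MuCarrier)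
open Summit.BirchSwinnertonDyer.Rank1Residual.X11b
open Summit.BirchSwinnertonDyer.Rank1Residual.X11b.FiniteDuality
open Summit.BirchSwinnertonDyer.Rank1Residual.X11b.Relaxation
open scoped ContRepresentation

open Summit.BirchSwinnertonDyer.BirchSwinnertonDyer.Theorems.CongruentShaFreeCutTwoAdicSelmerLocIndex
open Summit.BirchSwinnertonDyer.BirchSwinnertonDyer.Theorems.CongruentShaFreeCutTwoAdicSelmerCorankSupplies

/-! ## 1. The level bound and the finiteness of `Sel_𝔭(K, E[p^∞])` from two level hypotheses -/

section Level

open Summit.BirchSwinnertonDyer.Rank1Residual.X11b.AcSelmer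
open Summit.BirchSwinnertonDyer.Rank1Residual.X11b.SelmerLevelBound

variable {K : Type} [Field K] [NumberField K] (E : WeierstrassCurve K) [E.IsElliptic] (p : ℕ)
  [Fact p.Prime]

/-- **The level bound in corank currency.** Let `k ≥ 1`, `𝔭` a prime of `K` above `p` and `𝔮` the
only other prime above `p` (if any). If the image of `Sel^{(p^k)}(E/K)` in the local Kummer condition
`𝓛_𝔮 ≅ E(K_𝔮)/p^k` has index `≤ B₂`, and the part of `Sel^{(p^k)}(E/K)` whose localisation at `𝔭`
is TORSION-VALUED (`loc_𝔭 c ∈ κ_𝔭(E(K_𝔭)_tors)`, i.e. `c ↦ 0 ∈ H¹(K_𝔭, E[p^∞])`) has order `≤ B₁`,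
then Castella's level-`k` group satisfies `#H¹_{𝓛^{(k)}}(K, E[p^k]) ≤ B₂ · B₁`:
`H¹_{𝓛^{(k)}} ⊆ H¹_{𝓛, ⊤ at 𝔮} ∩ loc_𝔭⁻¹ κ_𝔭(T)` (tree, `LevelKummer`), `#(A ∩ C) ≤ [A : Sel]·#(Sel ∩ C)`,
and `[H¹_{𝓛,⊤ at 𝔮} : Sel] ≤ [𝓛_𝔮 : loc_𝔮 Sel]` (Poitou–Tate, §1). NO Mordell–Weil point, NO
hypothesis on `E(K)[p]`, `E(K_𝔭)[p]`, the reduction type or `Ш`.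
[cite: JetchevSkinnerWan2017, Prop. 3.2.1 (proof, arXiv:1512.06894 pp. 10–11)]
[cite: Castella2018, proof of Thm. 2.3, (3.2.1) (arXiv:1704.06608 pp. 5–6)]
[cite: MilneADT2006, Ch. I, Thm. 4.10(b) and Thm. 2.8] -/
theorem finite_and_natCard_level_le_of_locIndex_of_torsionValued (k : ℕ) (hk : 0 < k)
    (𝔭 𝔮 : HeightOneSpectrum (𝓞 K))
    (h𝔮 : ∀ v : HeightOneSpectrum (𝓞 K), v ≠ 𝔭 → ((p : ℕ) : 𝓞 K) ∈ v.asIdeal → v = 𝔮)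
    (hPT : poitouTate_sum_localTatePairing_eq_zero K)
    (hEP : localEulerPoincareCharacteristic (𝔮.adicCompletion K))
    (hn : ((p ^ k : ℕ) : ℤ) ≠ 0) {B₁ B₂ : ℕ}
    (hB₂ : ((selmerGroup E ((p ^ k : ℕ) : ℤ)).map
          (galoisCohomology.localization (E.torsionGaloisModule ((p ^ k : ℕ) : ℤ)) (Sum.inr 𝔮) 1)).relIndex
        (E.kummerSelmerStructure ((p ^ k : ℕ) : ℤ) (Sum.inr 𝔮)) ≤ B₂)
    (hB₁ : Nat.card ↥(selmerGroup E ((p ^ k : ℕ) : ℤ) ⊓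
        ((AddCommGroup.torsion (E.baseChange (𝔭.adicCompletion K)).toAffine.Point).map
          (E.localKummerMap (𝔭.adicCompletion K) hn)).comap
          (galoisCohomology.res (E.torsionGaloisModule ((p ^ k : ℕ) : ℤ)) (𝔭.adicCompletion K) 1)) ≤ B₁) :
    Finite (acLevelStructure E p k 𝔭 ∅).selmerGroup ∧
      Nat.card (acLevelStructure E p k 𝔭 ∅).selmerGroup ≤ B₂ * B₁ := by
  have hp : p.Prime := Fact.out
  haveI : NeZero (p ^ k) := ⟨pow_ne_zero _ hp.ne_zero⟩
  haveI : CharZero (𝔭.adicCompletion K) := charZero_adicCompletion 𝔭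
  set n : ℕ := p ^ k with hndef
  set Sel := selmerGroup E (n : ℤ) with hSel
  set KO := kummerOutside E n {Sum.inr 𝔮} with hKO
  set C := ((AddCommGroup.torsion (E.baseChange (𝔭.adicCompletion K)).toAffine.Point).map
      (E.localKummerMap (𝔭.adicCompletion K) hn)).comap
    (galoisCohomology.res (E.torsionGaloisModule (n : ℤ)) (𝔭.adicCompletion K) 1) with hC
  have hT : ∀ v : HeightOneSpectrum (𝓞 K), v ≠ 𝔭 →
      (((p : ℕ) : 𝓞 K) ∈ v.asIdeal ∨ v ∈ (∅ : Set (HeightOneSpectrum (𝓞 K)))) →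
        (Sum.inr v : Place K) ∈ ({Sum.inr 𝔮} : Finset (Place K)) := by
    rintro v hv (hpv | hv0)
    · rw [h𝔮 v hv hpv, Finset.mem_singleton]
    · exact absurd hv0 (Set.notMem_empty v)
  haveI hKOfin : Finite KO := finite_kummerOutside E n {Sum.inr 𝔮}
  haveI : Finite ↥(KO ⊓ C) := Finite.of_injective _ (AddSubgroup.inclusion_injective inf_le_left)
  haveI : Finite ↥(kummerOutside E (p ^ k) {Sum.inr 𝔮} ⊓
      ((AddCommGroup.torsion
          (E.baseChange (Place.Completion (Sum.inr 𝔭 : Place K))).toAffine.Point).map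
        (E.localKummerMap (Place.Completion (Sum.inr 𝔭 : Place K)) hn)).comap
        (galoisCohomology.localization (E.torsionGaloisModule ((p ^ k : ℕ) : ℤ)) (Sum.inr 𝔭) 1)) :=
    Finite.of_injective _ (AddSubgroup.inclusion_injective inf_le_left)
  obtain ⟨hfin, hglue⟩ :=
    LevelKummer.finite_and_natCard_selmerGroup_acLevelStructure_le_torsion E p k 𝔭 ∅ {Sum.inr 𝔮}
      hT hn
  refine ⟨hfin, ?_⟩
  have hglue' : Nat.card (acLevelStructure E p k 𝔭 ∅).selmerGroup ≤ Nat.card ↥(KO ⊓ C) := hglue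
  have hSelKO : Sel ≤ KO := selmerGroup_le_kummerOutside E n _
  have h2 : Nat.card ↥(KO ⊓ C) ≤ Sel.relIndex KO * Nat.card ↥(Sel ⊓ C) :=
    natCard_inf_le_relIndex_mul KO Sel C hSelKO
  have hpp : IsPrimePow n := ⟨p, k, hp.prime, hk, rfl⟩
  have hB : Sel.relIndex KO ≤ B₂ :=
    (relIndex_selmerGroup_kummerOutside_le_locIndex_of_facts E n 𝔮 hpp hPT hEP).trans hB₂
  calc Nat.card (acLevelStructure E p k 𝔭 ∅).selmerGroup ≤ Nat.card ↥(KO ⊓ C) := hglue'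
    _ ≤ Sel.relIndex KO * Nat.card ↥(Sel ⊓ C) := h2
    _ ≤ B₂ * B₁ := Nat.mul_le_mul hB hB₁

/-- **`Sel_𝔭(K, E[p^∞])` is finite from the two level hypotheses, uniformly in `k`.** With `𝔭`, `𝔮`
as above: if for every `k ≥ 1` the index of `loc_𝔮 Sel^{(p^k)}(E/K)` in `𝓛_𝔮` is `≤ B₂` and the
`𝔭`-torsion-valued part of `Sel^{(p^k)}(E/K)` has order `≤ B₁`, then Castella's Selmer group over `K`
(strict at `𝔭`, relaxed at `𝔮`, trivial off `p`; `X11b.AcSelmer.selmerAcBase E p 𝔭 ∅`) is finite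
(level bounds + the tree's passage to the limit `LevelKummer.exists_finite_selmerAcBase_natCard_le`).
CONDITIONAL on the two textbook facts `hPT`, `hEP`. [cite: JetchevSkinnerWan2017, Prop. 3.2.1 (arXiv:1512.06894 pp. 10–11)]
[cite: Castella2018, Def. 2.2 and (3.2.1) (arXiv:1704.06608 pp. 5–6)] [cite: MilneADT2006, Ch. I, Thm. 4.10(b) and Thm. 2.8] -/
theorem finite_selmerAcBase_of_locIndex_of_torsionValued (𝔭 𝔮 : HeightOneSpectrum (𝓞 K))
    (h𝔮 : ∀ v : HeightOneSpectrum (𝓞 K), v ≠ 𝔭 → ((p : ℕ) : 𝓞 K) ∈ v.asIdeal → v = 𝔮)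
    (hPT : poitouTate_sum_localTatePairing_eq_zero K)
    (hEP : localEulerPoincareCharacteristic (𝔮.adicCompletion K)) (B₁ B₂ : ℕ)
    (hB₂ : ∀ k : ℕ, 0 < k →
      ((selmerGroup E ((p ^ k : ℕ) : ℤ)).map
          (galoisCohomology.localization (E.torsionGaloisModule ((p ^ k : ℕ) : ℤ)) (Sum.inr 𝔮) 1)).relIndex
        (E.kummerSelmerStructure ((p ^ k : ℕ) : ℤ) (Sum.inr 𝔮)) ≤ B₂)
    (hB₁ : ∀ k : ℕ, 0 < k →
      Nat.card ↥(selmerGroup E ((p ^ k : ℕ) : ℤ) ⊓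
        ((AddCommGroup.torsion (E.baseChange (𝔭.adicCompletion K)).toAffine.Point).map
          (E.localKummerMap (𝔭.adicCompletion K)
            (Int.natCast_ne_zero.mpr (pow_ne_zero k (Fact.out : p.Prime).ne_zero)))).comap
          (galoisCohomology.res (E.torsionGaloisModule ((p ^ k : ℕ) : ℤ)) (𝔭.adicCompletion K) 1)) ≤ B₁) :
    Finite (selmerAcBase E p 𝔭 ∅) := by
  have hp : p.Prime := Fact.out
  have hlevel : ∀ k, Finite (acLevelStructure E p k 𝔭 ∅).selmerGroup ∧
      Nat.card (acLevelStructure E p k 𝔭 ∅).selmerGroup ≤ B₂ * B₁ + 1 := by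
    intro k
    rcases Nat.eq_zero_or_pos k with rfl | hk
    · obtain ⟨hfin, hle⟩ := finite_and_natCard_selmerGroup_acLevelStructure_zero E p 𝔭 ∅
      exact ⟨hfin, hle.trans (Nat.le_add_left 1 _)⟩
    · obtain ⟨hfin, hle⟩ := finite_and_natCard_level_le_of_locIndex_of_torsionValued E p k hk 𝔭 𝔮
        h𝔮 hPT hEP (Int.natCast_ne_zero.mpr (pow_ne_zero k hp.ne_zero)) (hB₂ k hk) (hB₁ k hk)
      exact ⟨hfin, hle.trans (Nat.le_add_right _ 1)⟩
  obtain ⟨hfinSel, -⟩ := LevelKummer.exists_finite_selmerAcBase_natCard_le E p 𝔭 ∅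
    E.zsmul_geomPoints_surjective_holds (B₂ * B₁ + 1) (fun k => (hlevel k).1) (fun k => (hlevel k).2)
  exact hfinSel

end Level

/-! ## 2. `Sel_𝔭(K, E[p^∞])` is finite at a CORANK-one datum, granted visibility at `p` -/

section Main

open Summit.BirchSwinnertonDyer.Rank1Residual.X11b.AcSelmer

/-- **`Sel_𝔭(K, E[p^∞])` is FINITE at a corank-one datum, GRANTED that the corank is visible at the
primes above `p`.** For an elliptic, globally minimal `W/ℚ`, a prime `p`, an imaginary quadratic
field `K` in which `p` splits, and a prime `𝔭 ∋ p` of `K`: if `corank_{ℤ_p} Sel_{p^∞}(E/K) = 1` and,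
for each prime `𝔮 ∣ p` of `K`, the `𝔮`-TORSION-VALUED parts of the `p^k`-Selmer groups — the classes
`c ∈ Sel^{(p^k)}(E/K)` with `loc_𝔮 c ∈ κ_𝔮(E(K_𝔮)_tors)`, i.e. `c ↦ 0` in `H¹(K_𝔮, E[p^∞])` — have
order bounded independently of `k`, then Castella's Selmer group `Sel_𝔭(K, E[p^∞])` (strict at `𝔭`,
relaxed at `𝔭̄`, trivial off `p`; `X11b.AcSelmer.selmerAcBase (W_K) p 𝔭 ∅`) is finite. Proof: at
level `p^k`, `#H¹_{𝓛^{(k)}} ≤ [𝓛_𝔮 : loc_𝔮 Sel^{(p^k)}] · #(Sel^{(p^k)} ∩ loc_𝔭⁻¹κ_𝔭(T))` (§1, Poitou–Tate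
with the Selmer group's own local image); the second factor is the hypothesis at `𝔭`; the first is
`≤ #E(ℚ_p)_tors ·` (hypothesis at `𝔮`) because `#𝓛_𝔮 ≤ #E(ℚ_p)_tors · p^k` (part 2) while corank one
forces `#Sel^{(p^k)} ≥ p^k` (part 2: a point of infinite order, or a copy of `ℚ_p/ℤ_p` in `Ш[p^∞]`);
uniform level bounds give finiteness (tree `LevelKummer`). When `rank E(K) = 1` and `Ш[p^∞]` is finite
the visibility hypothesis HOLDS (the cell's `finite_selmerAcBase_of_rankOne`, s2-c3 g3, is the same
chain with the Mordell–Weil point supplying both factors); the hypothesis carries content exactly when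
the corank is carried by `Ш(E/K)[p^∞]`: it excludes an infinitely divisible `Ш`-class dying in
`H¹(K_𝔮, E[p^∞])` at a prime `𝔮` above `p` — the step a `p`-CONVERSE theorem in corank currency must
supply beyond the rank-one case (in print, at good ordinary `p`, it comes from the Heegner-point main
conjecture through the `Λ`-adic explicit reciprocity law: CGLS 2022 §5.2, proof of Thm. 5.2.1;
Burungale–Castella–Skinner–Tian 2022 §1 "The approach" for CM curves; nothing of this is in print for
an additive prime). CONDITIONAL on the two textbook facts `hPT` (Milne ADT I 4.10(b)/2.3) and `hEP`
(Milne I 2.8). [cite: CastellaGrossiLeeSkinner2022, §5.2, proof of Thm. 5.2.1 (shape only; nothing asserted)]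
[cite: BurungaleCastellaSkinnerTian2022, §1 ("The approach") and Remark D (shape only; nothing asserted)]
[cite: JetchevSkinnerWan2017, Prop. 3.2.1 (proof, arXiv:1512.06894 pp. 10–11)]
[cite: Castella2018, Def. 2.2, Thm. 2.3 and (3.2.1) (arXiv:1704.06608 pp. 5–6)]
[cite: MilneADT2006, Ch. I, Thm. 4.10(b) and Thm. 2.8] [cite: SilvermanAEC2009, Thm. X.4.2 and Prop. VII.6.3] -/
theorem finite_selmerAcBase_of_selmerCorank_eq_one_of_torsionValued (W : WeierstrassCurve ℚ)
    [W.IsElliptic] [W.IsGloballyMinimal] (p : ℕ) [Fact p.Prime] (K : Type) [Field K] [NumberField K]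
    (hPT : poitouTate_sum_localTatePairing_eq_zero K)
    (hEP : ∀ v : HeightOneSpectrum (𝓞 K), localEulerPoincareCharacteristic (v.adicCompletion K))
    (hK : IsImaginaryQuadratic K) (hsplit : SplitsIn K p)
    (hcork : (W.baseChange K).selmerCorank p = 1)
    (hvis : ∀ 𝔮 : HeightOneSpectrum (𝓞 K), ((p : ℕ) : 𝓞 K) ∈ 𝔮.asIdeal → ∃ B : ℕ, ∀ k : ℕ, 0 < k →
      Nat.card ↥(selmerGroup (W.baseChange K) ((p ^ k : ℕ) : ℤ) ⊓
        ((AddCommGroup.torsion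
            ((W.baseChange K).baseChange (𝔮.adicCompletion K)).toAffine.Point).map
          ((W.baseChange K).localKummerMap (𝔮.adicCompletion K)
            (Int.natCast_ne_zero.mpr (pow_ne_zero k (Fact.out : p.Prime).ne_zero)))).comap
          (galoisCohomology.res ((W.baseChange K).torsionGaloisModule ((p ^ k : ℕ) : ℤ))
            (𝔮.adicCompletion K) 1)) ≤ B)
    (𝔭 : HeightOneSpectrum (𝓞 K)) (h𝔭 : ((p : ℕ) : 𝓞 K) ∈ 𝔭.asIdeal) :
    Finite (selmerAcBase (W.baseChange K) p 𝔭 ∅) := by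
  have hp : p.Prime := Fact.out
  set E := W.baseChange K with hE
  haveI hEK : E.IsElliptic := by rw [hE, baseChange]; infer_instance
  have h2 : Module.finrank ℚ K = 2 := hK.1
  obtain ⟨σ, 𝔮, -, -, h𝔮p, hall⟩ :=
    LocalIndexTransport.exists_conj_prime_of_splitsIn K p h2 hsplit h𝔭
  have h𝔮 : ∀ v : HeightOneSpectrum (𝓞 K), v ≠ 𝔭 → ((p : ℕ) : 𝓞 K) ∈ v.asIdeal → v = 𝔮 :=
    fun v hv hpv ↦ (hall v hpv).resolve_left hv
  obtain ⟨he, hf⟩ := degreeOne_of_splitsIn h2 hsplit h𝔮p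
  obtain ⟨B₁, hB₁⟩ := hvis 𝔭 h𝔭
  obtain ⟨B₁', hB₁'⟩ := hvis 𝔮 h𝔮p
  set t := Nat.card (AddCommGroup.torsion (W.baseChange ℚ_[p]).toAffine.Point) with ht
  refine finite_selmerAcBase_of_locIndex_of_torsionValued E p 𝔭 𝔮 h𝔮 hPT (hEP 𝔮) B₁ (t * B₁') ?_ hB₁
  intro k hk
  haveI : NeZero (p ^ k) := ⟨pow_ne_zero _ hp.ne_zero⟩
  have hn : ((p ^ k : ℕ) : ℤ) ≠ 0 := Int.natCast_ne_zero.mpr (pow_ne_zero k hp.ne_zero)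
  obtain ⟨_, hL⟩ := natCard_kummerSelmerStructure_le_torsion_mul_pow W p K 𝔮 h𝔮p he hf k
  have hbig := pow_le_natCard_selmerGroup_of_selmerCorank_eq_one E p hcork k
  refine locIndex_le_of_torsionValued_of_card E (p ^ k) 𝔮 hn (hB₁' k hk) ?_
  calc Nat.card (E.kummerSelmerStructure ((p ^ k : ℕ) : ℤ) (Sum.inr 𝔮)) ≤ t * p ^ k := hL
    _ ≤ t * Nat.card (selmerGroup E ((p ^ k : ℕ) : ℤ)) := Nat.mul_le_mul_left _ hbig

end Main

end Summit.BirchSwinnertonDyer.BirchSwinnertonDyer.Theorems.CongruentShaFreeCutTwoAdicSelmerFiniteCorank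

end
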